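import Mathlib.Analysis.Calculus.ContDiff.Operations
import Mathlib.Analysis.Calculus.FDeriv.CompCLM
import Literature.Analysis.Calculus.FixedPointSmoothDependence
import Literature.Analysis.Calculus.QuadraticSolutionMapDeriv
import HarnessLib

/-!
# `C^∞` dependence of the solution of `w = A g + F₀ − Q(w, w)` on the datum `g`

Analysis/Calculus support file (everything proved; no definitions, no named facts).  The abstract
functional-analytic core of "the mild solution of a semilinear parabolic equation with a quadratic
nonlinearity depends smoothly on its initial value" (D. Henry, *Geometric Theory of Semilinear
Parabolic Equations*, LNM 840 (1981), Thm. 3.4.4; the uniform contraction principle, S.-N. Chow,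
J. K. Hale, *Methods of Bifurcation Theory* (1982), §2.2): for Banach spaces `E` (data) and `X`
(solution curves), a bounded linear `A : E → X`, a fixed forcing `F₀ : X` and a bounded bilinear
`Q : X × X → X` with `‖Q y z‖ ≤ L ‖y‖ ‖z‖`, consider the Picard map

  `P (g, w) = A g + F₀ − Q (w, w)`.

If `‖A g + F₀‖ + L R² ≤ R` for `‖g‖ < ρ` (self-map of the closed `R`-ball) and `2 L R < 1`
(contraction), then (`exists_contDiffOn_quadraticSolutionMap`) there is a solution map `Ψ : E → X`
with, for `‖g‖ < ρ`: `Ψ g = A g + F₀ − Q (Ψ g, Ψ g)`, `‖Ψ g‖ ≤ R`, `Ψ g` the only solution in the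
closed `R`-ball, **`Ψ` of class `C^∞` on the open `ρ`-ball**, and the derivative identity

  `DΨ(g) h = A h − (Q (Ψ g, DΨ(g) h) + Q (DΨ(g) h, Ψ g))`

(the derivative solves the linearised equation).  Existence is Banach's fixed point theorem on the
closed ball (the tree's `exists_isFixedPt_mem_closedBall`), continuity and smoothness of `Ψ` are the
tree's uniform contraction principle `continuousAt_fixedPoint_of_lipschitz` / `contDiffAt_fixedPoint`
(`FixedPointSmoothDependence.lean`: `P` is a continuous polynomial, hence `C^∞`, and
`‖∂_w P (g, Ψ g)‖ ≤ 2 L R < 1`), and the derivative identity is the chain rule applied to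
`Ψ g = P (g, Ψ g)`.  The sibling `QuadraticSolutionMapDeriv.lean` treats `F₀ = 0` with the strict
derivative at `g = 0` only; here the radii are prescribed by the two displayed inequalities, which is
the form needed when smallness comes from a short time interval rather than from small data.

## References

* D. Henry, *Geometric Theory of Semilinear Parabolic Equations*, LNM 840, Springer (1981), Thm. 3.4.4,
  Lemma 3.4.5. [Henry1981]
* S.-N. Chow, J. K. Hale, *Methods of Bifurcation Theory*, Springer (1982), §2.2. [ChowHale1982]
-/

noncomputable section

open Set Metric Filter Function
open _root_.Topology
open scoped ContDiff

namespace Literature.Analysis.Calculus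

variable {E X : Type*} [NormedAddCommGroup E] [NormedSpace ℝ E] [CompleteSpace E]
  [NormedAddCommGroup X] [NormedSpace ℝ X] [CompleteSpace X]

omit [CompleteSpace E] [CompleteSpace X] in
/-- The quadratic map `w ↦ Q w w` with `‖Q y z‖ ≤ L‖y‖‖z‖` is Lipschitz with constant `L (‖w₁‖ + ‖w₂‖)`:
`Q w₁ w₁ − Q w₂ w₂ = Q w₁ (w₁ − w₂) + Q (w₁ − w₂) w₂`. [folklore] -/
theorem norm_bilinear_diag_sub_le_of_le (Q : X →L[ℝ] X →L[ℝ] X) {L : ℝ}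
    (hQ : ∀ y z, ‖Q y z‖ ≤ L * ‖y‖ * ‖z‖) (w₁ w₂ : X) :
    ‖Q w₁ w₁ - Q w₂ w₂‖ ≤ L * (‖w₁‖ + ‖w₂‖) * ‖w₁ - w₂‖ := by
  have hsplit : Q w₁ w₁ - Q w₂ w₂ = Q w₁ (w₁ - w₂) + Q (w₁ - w₂) w₂ := by
    simp only [map_sub, FunLike.coe_sub, Pi.sub_apply]; abel
  rw [hsplit]
  calc ‖Q w₁ (w₁ - w₂) + Q (w₁ - w₂) w₂‖ ≤ ‖Q w₁ (w₁ - w₂)‖ + ‖Q (w₁ - w₂) w₂‖ := norm_add_le _ _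
    _ ≤ L * ‖w₁‖ * ‖w₁ - w₂‖ + L * ‖w₁ - w₂‖ * ‖w₂‖ := add_le_add (hQ _ _) (hQ _ _)
    _ = L * (‖w₁‖ + ‖w₂‖) * ‖w₁ - w₂‖ := by ring

omit [CompleteSpace E] [CompleteSpace X] in
/-- The Picard map `P (g, w) = A g + F₀ − Q w w` has derivative
`(h, v) ↦ A h − (Q w v + Q v w)` at `(g, w)` (chain rule for a bounded bilinear map). [folklore] -/
theorem hasFDerivAt_quadraticPicard (A : E →L[ℝ] X) (F₀ : X) (Q : X →L[ℝ] X →L[ℝ] X) (p : E × X) :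
    HasFDerivAt (fun q : E × X => A q.1 + F₀ - Q q.2 q.2)
      (A.comp (ContinuousLinearMap.fst ℝ E X) -
        ((Q p.2).comp (ContinuousLinearMap.snd ℝ E X) +
          (Q.comp (ContinuousLinearMap.snd ℝ E X)).flip p.2)) p := by
  have hA := ((A.comp (ContinuousLinearMap.fst ℝ E X)).hasFDerivAt (x := p)).add_const F₀
  have hS := (ContinuousLinearMap.snd ℝ E X).hasFDerivAt (x := p)
  have hQ : HasFDerivAt (fun q : E × X => Q q.2) (Q.comp (ContinuousLinearMap.snd ℝ E X)) p :=
    Q.hasFDerivAt.comp p hS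
  exact hA.sub (hQ.clm_apply hS)

/-- **`C^∞` dependence of the solution of `w = A g + F₀ − Q(w,w)` on `g`** (Henry 1981, Thm. 3.4.4;
uniform contraction principle, Chow–Hale 1982, §2.2).  Let `A : E →L X`, `F₀ : X` and a bounded bilinear
`Q` with `‖Q y z‖ ≤ L‖y‖‖z‖` (`L ≥ 0`) on Banach spaces be given, together with radii `ρ`, `R ≥ 0` such
that `‖A g + F₀‖ + L R² ≤ R` for `‖g‖ < ρ` and `2 L R < 1`.  Then there is `Ψ : E → X` such that for every
`g` with `‖g‖ < ρ`: `Ψ g = A g + F₀ − Q (Ψ g) (Ψ g)`, `‖Ψ g‖ ≤ R`, every solution `z` of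
`z = A g + F₀ − Q z z` with `‖z‖ ≤ R` equals `Ψ g`; moreover `Ψ` is `C^∞` on the open ball `‖g‖ < ρ` and
`DΨ(g) h = A h − (Q (Ψ g) (DΨ(g) h) + Q (DΨ(g) h) (Ψ g))`. [cite: Henry1981, Thm 3.4.4] -/
theorem exists_contDiffOn_quadraticSolutionMap (A : E →L[ℝ] X) (F₀ : X) (Q : X →L[ℝ] X →L[ℝ] X)
    {ρ R L : ℝ} (hR : 0 ≤ R) (hL : 0 ≤ L) (hQ : ∀ y z, ‖Q y z‖ ≤ L * ‖y‖ * ‖z‖)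
    (hself : ∀ g ∈ ball (0 : E) ρ, ‖A g + F₀‖ + L * R ^ 2 ≤ R) (hcontr : 2 * L * R < 1) :
    ∃ Ψ : E → X, ContDiffOn ℝ ∞ Ψ (ball 0 ρ) ∧
      (∀ g ∈ ball (0 : E) ρ, Ψ g = A g + F₀ - Q (Ψ g) (Ψ g)) ∧
      (∀ g ∈ ball (0 : E) ρ, ‖Ψ g‖ ≤ R) ∧
      (∀ g ∈ ball (0 : E) ρ, ∀ z : X, ‖z‖ ≤ R → z = A g + F₀ - Q z z → z = Ψ g) ∧
      (∀ g ∈ ball (0 : E) ρ, ∀ h : E,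
        fderiv ℝ Ψ g h = A h - (Q (Ψ g) (fderiv ℝ Ψ g h) + Q (fderiv ℝ Ψ g h) (Ψ g))) := by
  -- the Picard map and its uniform Lipschitz estimate on the closed `R`-ball
  set P : E × X → X := fun q => A q.1 + F₀ - Q q.2 q.2 with hP
  have hlipest : ∀ (g : E) (y z : X), ‖y‖ ≤ R → ‖z‖ ≤ R →
      ‖P (g, y) - P (g, z)‖ ≤ 2 * L * R * ‖y - z‖ := by
    intro g y z hy hz
    have h1 : P (g, y) - P (g, z) = -(Q y y - Q z z) := by
      simp only [hP]; abel
    rw [h1, norm_neg]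
    calc ‖Q y y - Q z z‖ ≤ L * (‖y‖ + ‖z‖) * ‖y - z‖ := norm_bilinear_diag_sub_le_of_le Q hQ y z
      _ ≤ L * (R + R) * ‖y - z‖ := by gcongr
      _ = 2 * L * R * ‖y - z‖ := by ring
  set k : NNReal := ⟨2 * L * R, by positivity⟩ with hk
  have hkcoe : (k : ℝ) = 2 * L * R := rfl
  have hk1 : (k : ℝ) < 1 := by rw [hkcoe]; exact hcontr
  have hk1' : k < 1 := by exact_mod_cast hk1
  have hlip : ∀ g : E, LipschitzOnWith k (fun y => P (g, y)) (closedBall (0 : X) R) := fun g =>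
    LipschitzOnWith.of_dist_le_mul fun y hy z hz => by
      rw [dist_eq_norm, dist_eq_norm, hkcoe]
      exact hlipest g y z (mem_closedBall_zero_iff.1 hy) (mem_closedBall_zero_iff.1 hz)
  have hmaps : ∀ g ∈ ball (0 : E) ρ, MapsTo (fun y => P (g, y)) (closedBall (0 : X) R)
      (closedBall (0 : X) R) := by
    intro g hg y hy
    rw [mem_closedBall_zero_iff] at hy ⊢
    calc ‖A g + F₀ - Q y y‖ ≤ ‖A g + F₀‖ + ‖Q y y‖ := norm_sub_le _ _
      _ ≤ ‖A g + F₀‖ + L * R ^ 2 := by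
          gcongr
          calc ‖Q y y‖ ≤ L * ‖y‖ * ‖y‖ := hQ y y
            _ ≤ L * R * R := by gcongr
            _ = L * R ^ 2 := by ring
      _ ≤ R := hself g hg
  -- the fixed points
  have hex : ∀ g ∈ ball (0 : E) ρ, ∃ y ∈ closedBall (0 : X) R, P (g, y) = y := fun g hg =>
    exists_isFixedPt_mem_closedBall hR hk1' (hmaps g hg) (hlip g)
  choose! Ψ hΨmem hΨfix using hex
  have hΨnorm : ∀ g ∈ ball (0 : E) ρ, ‖Ψ g‖ ≤ R := fun g hg => mem_closedBall_zero_iff.1 (hΨmem g hg)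
  -- uniqueness in the closed ball
  have huniq : ∀ g ∈ ball (0 : E) ρ, ∀ z : X, ‖z‖ ≤ R → z = A g + F₀ - Q z z → z = Ψ g := by
    intro g hg z hz hzeq
    have h1 : ‖z - Ψ g‖ ≤ 2 * L * R * ‖z - Ψ g‖ := by
      have hPz : P (g, z) = z := by simp only [hP]; exact hzeq.symm
      calc ‖z - Ψ g‖ = ‖P (g, z) - P (g, Ψ g)‖ := by rw [hΨfix g hg, hPz]
        _ ≤ 2 * L * R * ‖z - Ψ g‖ := hlipest g z (Ψ g) hz (hΨnorm g hg)
    have h3 : ‖z - Ψ g‖ ≤ 0 := by nlinarith [norm_nonneg (z - Ψ g)]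
    exact sub_eq_zero.1 (norm_le_zero_iff.1 h3)
  -- smoothness of the Picard map and its partial derivative
  have hPsmooth : ContDiff ℝ ∞ P :=
    ((A.contDiff.comp contDiff_fst).add contDiff_const).sub
      (Q.isBoundedBilinearMap.contDiff.comp (contDiff_snd.prodMk contDiff_snd))
  have hPcont : Continuous P := hPsmooth.continuous
  have hfixev : ∀ g ∈ ball (0 : E) ρ, ∀ᶠ g' in 𝓝 g, P (g', Ψ g') = Ψ g' := fun g hg => by
    filter_upwards [isOpen_ball.mem_nhds hg] with g' hg' using hΨfix g' hg'
  have hΨcont : ∀ g ∈ ball (0 : E) ρ, ContinuousAt Ψ g := fun g hg =>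
    continuousAt_fixedPoint_of_lipschitz (T := P) (B := closedBall (0 : X) R) hk1 (hΨmem g hg)
      (by filter_upwards [isOpen_ball.mem_nhds hg] with g' hg' using hΨmem g' hg')
      (Eventually.of_forall fun g' => hlip g') (hfixev g hg)
      ((hPcont.comp (continuous_id.prodMk continuous_const)).continuousAt)
  have hcontrD : ∀ g ∈ ball (0 : E) ρ,
      ‖fderiv ℝ P (g, Ψ g) ∘L ContinuousLinearMap.inr ℝ E X‖ < 1 := by
    intro g hg
    rw [(hasFDerivAt_quadraticPicard A F₀ Q (g, Ψ g)).fderiv]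
    refine lt_of_le_of_lt (ContinuousLinearMap.opNorm_le_bound _ (by positivity) fun w => ?_) hcontr
    simp only [ContinuousLinearMap.comp_apply, ContinuousLinearMap.inr_apply,
      FunLike.coe_sub, Pi.sub_apply, FunLike.coe_add, Pi.add_apply,
      ContinuousLinearMap.coe_fst', ContinuousLinearMap.coe_snd', ContinuousLinearMap.flip_apply,
      map_zero, zero_sub, norm_neg]
    calc ‖Q (Ψ g) w + Q w (Ψ g)‖ ≤ ‖Q (Ψ g) w‖ + ‖Q w (Ψ g)‖ := norm_add_le _ _
      _ ≤ L * ‖Ψ g‖ * ‖w‖ + L * ‖w‖ * ‖Ψ g‖ := add_le_add (hQ _ _) (hQ _ _)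
      _ ≤ L * R * ‖w‖ + L * ‖w‖ * R := by gcongr <;> exact hΨnorm g hg
      _ = 2 * L * R * ‖w‖ := by ring
  have hsmooth : ∀ g ∈ ball (0 : E) ρ, ContDiffAt ℝ ∞ Ψ g := fun g hg =>
    contDiffAt_fixedPoint (by simp) hPsmooth.contDiffAt (hcontrD g hg) (hfixev g hg) (hΨcont g hg)
  refine ⟨Ψ, fun g hg => (hsmooth g hg).contDiffWithinAt, fun g hg => (hΨfix g hg).symm, hΨnorm,
    huniq, fun g hg h => ?_⟩
  -- the derivative identity: differentiate `Ψ g' = P (g', Ψ g')` at `g`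
  have hΨ' : HasFDerivAt Ψ (fderiv ℝ Ψ g) g :=
    ((hsmooth g hg).differentiableAt (by simp)).hasFDerivAt
  have hG : HasFDerivAt (fun g' => P (g', Ψ g'))
      (A - ((Q (Ψ g)).comp (fderiv ℝ Ψ g) + (Q.comp (fderiv ℝ Ψ g)).flip (Ψ g))) g := by
    have hQΨ : HasFDerivAt (fun g' => Q (Ψ g')) (Q.comp (fderiv ℝ Ψ g)) g :=
      Q.hasFDerivAt.comp g hΨ'
    exact (A.hasFDerivAt.add_const F₀).sub (hQΨ.clm_apply hΨ')
  have hkey : HasFDerivAt Ψ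
      (A - ((Q (Ψ g)).comp (fderiv ℝ Ψ g) + (Q.comp (fderiv ℝ Ψ g)).flip (Ψ g))) g :=
    hG.congr_of_eventuallyEq (by
      filter_upwards [isOpen_ball.mem_nhds hg] with g' hg' using (hΨfix g' hg').symm)
  conv_lhs => rw [hkey.fderiv]
  simp only [FunLike.coe_sub, Pi.sub_apply, FunLike.coe_add, Pi.add_apply,
    ContinuousLinearMap.comp_apply, ContinuousLinearMap.flip_apply]

end Literature.Analysis.Calculus

end
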